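import Summits.QuantumFields.YangMills.Theorems.BalabanUVNodesK0AxJoinTBoxD9Images

/-!
# BalabanUVNodes — K0ᴬ: THE SINGLE-VOLUME (5.10) DECAY ROAD ON THE BOX, TOKEN-FREE — (E-lu-box), (L-dec-box), (L-absmom-box), the K0ᴬ door and the junction body from D1-box + the chart rows ALONE
  (★ P3 g90 `ym-nodeO-ideate-p3`, LENS P3 «weaken the target», №9 v2.1 PART 1∕2 — supersedes v1 20be4860c0fb5a2c ∕ v1.1 0e331f1e13a5156f (token editions) and v2 164ccd0fcf08085b (whose §11d
  `twoVolExpBox_LocUniv_images_geom` ★ PTB-1 g5 had meanwhile landed under the SAME name: ✓p819554 `…K0AxJoinTBoxD9Images` :50 — imported here instead, STATUS l.5095); after ✓`…K0AxJoinTBoxD9`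
  (★ P3 №8, ✓p819390) and ★ PTB-1 g5's METHOD OF IMAGES ✓p819059 ∕ ✓p819192 ∕ ✓p819266 `…PortU8ImagesPackage` + ✓p819554 `…K0AxJoinTBoxD9Images` (★★★ №549: «W4 (Tok-cmpU-cap) BYPASSED»); tree names only)

LANDING NOTE (porter ▶ PTC-1 g4, 2026-08-31; AUTHORSHIP = ★ P3 g90 «weaken the target», HOME sketch `nodeO-cover/P3-K0AxDecayBoxLocUniv-v2p1-A.lean` sha16 bcaed4d4f3f78a47 · 333 l. · 6 thm · 0 def
· 0 sorry = PART 1∕2 of P3's own 2-file cut of OFFER №9 v2.1 0a97afe1ffcbeff5 (the monolith exceeded the 400-line cap; cut at the §11g∕§11h boundary so every theorem has an in-file edge to a K0ᴬ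
door); kernel step ∕ `G`-parametrisation ◇ lens-1, D9∕(E-lu-box) images packages ★★★ PTB-1 (✓`…PortU8ImagesPackage`, ✓p819554 `…K0AxJoinTBoxD9Images`), RowG ∕ leaves ✓`PortHRecordRowG`): landed
VERBATIM (only this paragraph added) under P3's basename (`…K0AxDecayBoxD9`) on OFFER №9 (nodeO STATUS 10:09:14Z ∕ 10:20:55Z), after ✓p819390 `…K0AxJoinTBoxD9` (№8); ◆ CRIT-1 g37's cut + (Q-ord)
toy: CUT ×3 GO (nodeO STATUS 2026-08-31T10:44:10Z): combined farm run of №9A+№9B+№10 rc 0 · 0 warn · 0 sorry, axioms standard through №10's last door, dedup 16∕16 fresh, (Q-ord) PASS (every `∃ C₉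
δ₀`∕`∃ C δ₁`∕`∃ M` closed inside after `δ₀` is revealed), J1′∕J5′ PASS, SAME-WALL: located-genuine CONDITIONAL helpers whose price is every conjunct of `H` OPEN — incl. the one honest gap the
files name themselves: D1 is asked at every BOX history while ⁸∕⟨27930⟩ as signed delivers RUNS (Q-25, ★★★'s pen); helper `--supports stmt-QuantumFields-27238 --as helper` (NO `--workitem`).  PART
2∕2 = `…Theorems/BalabanUVNodesK0AxDecayBoxD9Junction.lean`.  HONEST (porter): CONDITIONAL theorems
over DISPLAYED row predicates + by-name doors from displayed hypotheses; (E-lu-box) ∕ (L-dec-box) ∕ [E] inhabited unconditionally NOWHERE; D1-on-the-box, the chart rows of ONE `ιC`, (V-cont-box) ∕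
(V-hess-cont-box), the sign letters — all OPEN Bałaban-strength content, asserted nowhere; nothing of Bałaban asserted, ported, discharged or refuted; K0ᴬ stmt-QuantumFields-27238 OPEN — NOTHING
of it proved; NODE O 0∕1; COUNT 8∕28 · K 1∕4 UNMOVED; finite 𝕋⁴ at fixed ε — NOT continuum ∕ OS ∕ Clay; the Yang–Mills mass gap is NOT proved by any of this.

WHY THIS FILE (LENS P3: which statement short of [B12] Thm 2 suffices — shrink the displayed residue of the K0ᴬ road to what is irreducible).  After ✓№8 the cofinal-radii K0ᴬ door
✓`record13SepCoPHInhabitedAx_of_cmp_chartRowsBox_pvolAbsMomentBox_cofinalRadii` (:363) displays, besides ⁸'s mould D1 on the box and the chart rows, TWO further letters: the volume-moment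
letter (V-absmom-box) `RecordPvolAbsMomentOnBoxAx F a₀ ε₂₉ γ₀ M` and the two-volume comparison token `K0AxJoinT.TokCmpUCap F Mc a₀`.  BOTH ARE PAID BY ROWS ALREADY IN THE TREE:
(i) the token — ★ PTB-1 g5's ✓`PortU8.portPieceLocalityU8_LocUniv_images (Mc a₀ hMc α₂ hα₂)` has the conclusion of ✓`portPieceLocalityU8_LocUniv_of_cmp` VERBATIM from `McGuard F Mc` and
`α₂ > 0` ALONE (D9 without a token); (ii) the moment letter — the SINGLE-VOLUME road of record ★★★ ✓`PortHRecordJoin.recordDecay_of_trace_L` gives the (5.10) decay `Decay510 (recordPlimAx …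
k v 0 1) C δ₁` of the record's OWN infinite-volume limit from D1 at the history `v` + the five-row package of ONE table + RowG + the (1.21) letter, and its constants `(C, δ₁)` do not depend on
`(k, v)`; on the box this is (L-dec-box) `K0RecordFormatNames.PlimDecayOnBoxOf`, whence (L-absmom-box) by ✓`K0AxMomentBox.recordPlimAbsMomentOnBoxAx_of_plimDecayOnBoxOf` (M := C); the
(1.21) box letter is ITSELF a consequence of (E-lu-box) (✓`K0AxMomentSocketTight.polLimitOnBoxOf_of_twoVolExpLocUnif`), and (E-lu-box) follows from the same rows (★ PTB-1 ✓`twoVolExpBox_LocUniv_images_geom`, `…K0AxJoinTBoxD9Images` :50 = ✓№8 §10d ∘ images).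
NET (§11g): **K0ᴬ `Record13SepCoPHInhabitedAx` BY NAME ⟸ ⁸'s mould D1 AT EVERY BOX HISTORY ∧ the swap ∕ `C²` ∕ zero ∕ link rows of ONE chart `ιC` against `recordGkLocWξ … univ` ∧ guards
(`McGuard F Mc`, `4·Mc ≤ Mg`, `0 ≤ E₀`, `4κ₀(64,8) ≤ κ`, `0 < γ₀ ≤ ½`, `0 < ε₂₉, α₀, α₁`), at cofinally small radii** — no moment, no decay, no (1.21), no Cauchy letter, no token displayed;
and the K0ᴬ–K1ᴬ junction's binder `hβc` (✓`…K0AxJunction` :171∕:271, body ✓`K0AxMomentBoxSocket.CofinalBetaSocketAxBody`) ⟸ the same + (V-cont-box) + the signed floor letter (§11i).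

THIS FILE (sorry-free; every hypothesis displayed; tree names only; namespace `…Theorems.K0AxMomentRoad`):
* §11a ★★★ `recordDecay_of_trace_G` — ✓`recordDecay_of_trace_L` (:63) with `L := 4` replaced by a GENERIC table `G` (D9 := ✓`K0AxJoinT.dataG`, chart cut := ✓`K0AxJoinT.chart_cut_members_G`,
  signed-distance flip := ✓`K0AxJoinT.flipG`, mirrored D9 := ✓`K0AxJoinT.response9D_flipG`): D1 at ONE history `v` + rows + RowG + (1.21)_v ⟹ `Decay510 (recordPlimAx F a₀ ε₂₉ k v 0 1) C δ₁`,
  `C = 16·E₀·C₉²·e^{δ₁ Mg c₁}·K₀'·K₁`, `δ₁ = delta1 δ₀ κ Mg` — INDEPENDENT of `(k, v)`.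
* §11b ★★★ `plimDecayOnBoxOf_of_rows_box_G` — D1 AT EVERY BOX HISTORY + the swap row + the per-level rows ⟨D9-`G`, `C²`∕zero, link-vs-`G`⟩ + RowG + (L-lim-box) ⟹ (L-dec-box).
* §11c `plimDecayOnBoxOf_of_rows_box_LocUniv_geom` — `G :=` the transverse table `recordGkLocWξ … univ`, D9 := `PortU8.Response9DAtLocUnivξ` BY NAME, RowG DISCHARGED by ★ P2
  ✓`PortHRecordRowG.rowG_slot8_at_names` (`c₁ = 2`, `K₁ = (2(1−e^{−δ₀∕2}))⁻⁴`, `K₀'` standard; guards `McGuard F Mc`, `4·Mc ≤ Mg`, `2κ₀ ≤ κ`).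
* (§11d is the TREE theorem ★ PTB-1 ✓`twoVolExpBox_LocUniv_images_geom` (`…K0AxJoinTBoxD9Images` :50) — ✓№8 :321 with `TokCmpUCap F Mc a₀ →` DELETED: `∀ ιC, D1-box → swap → chart rows →
  ∃ C₉ δ₀, 0 ≤ C₉ ∧ 0 < δ₀ ∧ (E-lu-box)`; imported, used BY NAME below.)
* §11e ★★★ `plimDecayOnBoxOf_LocUniv_images_geom` — (Q-ord)-CORRECT COMPOSITION ((f2)): `∀ ιC, D1-box → swap → chart rows → ∃ C δ₁, 0 ≤ C ∧ (L-dec-box)(γ₀, C, δ₁)`; the (1.21) box letter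
  from ✓`twoVolExpBox_LocUniv_images_geom` through ✓`polLimitOnBoxOf_of_twoVolExpLocUnif`; no leaf constant precedes `δ₀`.
* §11f ★★★ `absMomentBox_LocUniv_images_geom` — (L-absmom-box): `… → ∃ M, RecordPlimAbsMomentOnBoxAx F a₀ ε₂₉ γ₀ M`.
* §11g ★ `record13SepCoPHInhabitedAx_of_chartRowsBox_cofinalRadii` — THE COFINAL-RADII K0ᴬ DOOR WITH NEITHER MOMENT LETTER NOR TOKEN: `H := ∀ F a, 0 < a → ∃ a₀ ≤ a, ∃ γ₀ ε₂₉ E₀ κ Mg α₀ α₁ Mc,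
  guards ∧ ∃ ιC, D1-box ∧ swap ∧ chart rows` ⟹ K0ᴬ BY NAME (✓`K0AxMomentBox.record13SepCoPHInhabitedAx_of_k0AbsMomentBoxCofinalRadiiAx`).
* §11h∕§11i (the K0ᴬ–K1ᴬ JUNCTION editions: socket body at one radius, the binder `hβc` at cofinal radii, the K0ᴬ doors through the body) are PART 2∕2 = the sibling file
  `…Theorems/BalabanUVNodesK0AxDecayBoxD9Junction.lean` (gate 400-line cap; split at the §11g∕§11h boundary so that every theorem of either file sits on an in-file edge to a K0ᴬ door).

DEDUP: `recordDecay_of_trace_L`, `PortHDecayOfRowsTrace.*`, `K0AxMomentBox*`, `K0AxMomentSocket*`, `K0AxJoinT*`, `twoVolExpBox_LocUniv_images_geom` (✓p819554), `PortHRecordRowG.*`,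
`PortU8.*` are IMPORTED and used by name; every name and statement here is new (generic-`G` decay; decay∕moment ON THE BOX from D1-box; token-free compositions; the token-free doors).  (Q-ord) (◆ CRIT-1 g36 rider; ★★★ №543 (f2)): in
§11e∕§11f `δ₀` is revealed INSIDE (✓`portPieceLocalityU8_LocUniv_images`) before any constant is fixed, the conclusions `∃ C₉ δ₀, …` ∕ `∃ C δ₁, 0 ≤ C ∧ …` ∕ `∃ M, …` are closed;
§11a–§11c take `(C₉, δ₀, K₁, …)` as simultaneous universals with D9 BY NAME (no supplier order); the doors' `H` has no trailing supplier.

HONEST STATUS.  CONDITIONAL helpers over DISPLAYED rows, each OPEN Bałaban-strength content: D1 on the box (= W1 ⟨27930⟩'s consequent AT EVERY BOX HISTORY — ⁸ as signed gives RUNS,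
G-P3-6-1∕Q-25; ⟨27930⟩ OPEN: `stub_P0C`, `stub_G3C`, `stub_FE`), the swap∕`C²`∕zero∕link rows of ONE chart against `recordGkLocWξ … univ` ((ra-1)(ra-3)(ra-4) + `DressLink` ⟸ (C-orb) —
OPEN; ◇ lens-1 PART B types them at `recordEmbJDressed`), (V-cont-box) and the signed floor letter for the junction.  The images files' ◆ custody read-back is PENDING at writing time
(★★★ №549); this file uses their conclusion BY NAME only.  Nothing of Bałaban's renormalization-group analysis is asserted, ported, discharged or refuted; (E-lu-box) ∕ (L-dec-box)
inhabited unconditionally NOWHERE; K0ᴬ `Record13SepCoPHInhabitedAx` (stmt-QuantumFields-27238) OPEN; 27930 ∕ 26648 OPEN; NODE O 0∕1; COUNT 8∕28 · K 1∕4 UNMOVED; finite 𝕋⁴_{L^K}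
at fixed ε — NOT continuum ∕ OS ∕ Clay; **the Yang–Mills mass gap (Clay) is NOT proved.**

References: T. Bałaban, *Renormalization group approach to lattice gauge field theories. I*, Comm. Math. Phys. 109 (1987) 249–301 [Balaban1987RG1] — Thm 1 p.259,
Thm 2 (0.31) p.259, Thm 3 p.264, (0.20) p.256, (1.7) p.261, (1.18)–(1.22) pp.263–264, (4.4)–(4.5) pp.281–282, (4.35)–(4.37) pp.290–291, (5.10) p.293, (5.38)–(5.44)
pp.296–297; T. Bałaban, *The variational problem and background fields in renormalization group method for lattice gauge theories*, Comm. Math. Phys. 102 (1985) 277–309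
[Balaban1985Variational] — Prop. 9 p.309, (190) p.308, (137) p.298; T. Bałaban, *Propagators for lattice gauge theories in a background field*, Comm. Math. Phys. 99 (1985)
389–434 [Balaban1984PropagatorsI] — (1.63) p.28, Prop. 1.2 p.35; T. Bałaban, *Propagators … (II)*, Comm. Math. Phys. 96 (1984) 223–250 [Balaban1984PropagatorsII] — (2.35) p.228,
(2.130) p.246.
-/

noncomputable section

open Filter Topology
open scoped BigOperators Matrix.Norms.L2Operator

namespace Summit.QuantumFields.YangMills.Theorems.K0AxMomentRoad

open Literature.MathematicalPhysics.QuantumFieldTheory.Balaban1983to89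
open Literature.MathematicalPhysics.QuantumFieldTheory.Balaban1983to89.Node00 (TermFamily1 siteOfInt polWindow polScalar betaOfRecord₁₃Ax Stage13Params PolLimitExists)
open Literature.MathematicalPhysics.QuantumFieldTheory.Balaban1983to89.T4Continuum (T4Family)
open Literature.MathematicalPhysics.QuantumFieldTheory.Balaban1983to89.B12FormatPlus
open Literature.MathematicalPhysics.QuantumFieldTheory.Balaban1983to89.B12Decay510 (SiteGeometry GeomLeaf CubeSumLeaf TreeLeaf KernelBound delta1 delta1_pos mixedDeriv)
open Summit.QuantumFields.YangMills.Theorems.K0RecordFormatNames (ΦfOf pvolOf plimOf PlimDecayOnBoxOf PolLimitOnBoxOf)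
open Summit.QuantumFields.YangMills.Theorems.PortH (exists_cutTo_clm pvolOf_eq_trace)
open Summit.QuantumFields.YangMills.Theorems.K0RecordFormatNames
open Summit.QuantumFields.YangMills.Theorems.PortHRecordJoin (formatPlusG_chartSwap chartEquivariant_members noInvariantCovector_members chart_cut limit121_members l1_neg
  kappa₀_std_pos)
open Summit.QuantumFields.YangMills.Theorems.K0PortChart44DAtRecord (chart44DJ_record)
open Summit.QuantumFields.YangMills.Theorems.K0AxJoinT
open Summit.QuantumFields.YangMills.Theorems.PortHRecordRowG (rowG_slot8_at_names mc_pos)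
open Literature.MathematicalPhysics.QuantumFieldTheory.Balaban1983to89.FlowStep
open Literature.MathematicalPhysics.QuantumFieldTheory.Balaban1983to89.FlowStepRuns

/-! ## §11a  The single-volume (5.10) road at the MEMBER level with a GENERIC response table (✓`PortHRecordJoin.recordDecay_of_trace_L`, re-tabled) -/

/-- ★★★ **MEMBER LEVEL, ONE CHART `ιC`, GENERIC TABLE `G`** — ✓`PortH.decay510_plimOf_of_rows_trace` at the record names with `R := flipG … (G · a⋆)`, `Gc n a := G n a`, `ιe := ιC`:
⁸'s mould at the history `v` (ARBITRARY — it enters only through D1) ∧ the swap row to `ιC` ∧ per colour a «Prop. 9» receipt for `dataG … (G · a)` ∧ `ιC n` is `C²` at `0` with `ιC n 0 = 0` ∧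
the link `G n a l = Dι_C(0)[δ_l ⊗ bV a]` ∧ RowG (`GeomLeaf Mg c₁`, cube-sum leaf at `δ₀∕2`, tree leaf at `κ∕2`, eventual window identification) ∧ the (1.21) limit at `(k, v)` ⟹
**`Decay510 (recordPlimAx F a₀ ε₂₉ k v 0 1) (16·E₀·C₉²·e^{δ₁ Mg c₁}·K₀′·K₁) (delta1 δ₀ κ Mg)`**.  ✓`recordDecay_of_trace_L` is the case `G := recordGkL`, `ιC := ιL` (its proof, with ◇ lens-1's
`flipG ∕ response9D_flipG ∕ chart_cut_members_G` for `flipL ∕ …`).  CONDITIONAL over displayed rows; nothing of Bałaban asserted.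
[cite: Balaban1987RG1, (5.10) p.293, (1.19)–(1.21) pp.263–264, (4.35)–(4.37) pp.290–291, (1.10) p.262; Balaban1985Variational, Prop. 9 p.309, (21) p.281] -/
theorem recordDecay_of_trace_G {E₀ κ C₉ δ₀ Mg c₁ K₀' K₁ : ℝ}
    (hE₀ : 0 ≤ E₀) (hκ : 0 < κ) (hC₉ : 0 ≤ C₉) (hδ₀ : 0 < δ₀) (hMg : 0 < Mg) (hK₀' : 0 ≤ K₀') :
    ∀ (F : T4Family) (a₀ ε₂₉ α₀ α₁ : ℝ), 0 < α₀ → 0 < α₁ → ∀ (Mc k : ℕ) (v : Fin (k + 1) → ℝ),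
      letI θ := thetaFill F a₀ ε₂₉; letI := θ.instVβ₁; letI := θ.instVβ₂; letI := θ.instιβ
      ∀ (ιC : (n : ℕ) → recordW F a₀ ε₂₉ k (recordK₀ F Mc k + n) → (Fin (recordChartDimJ F (recordK₀ F Mc k + n)) → ℂ))
        (G : (n : ℕ) → θ.ιβ → RespLabel F k (recordK₀ F Mc k + n) → Fin (recordChartDimJ F (recordK₀ F Mc k + n)) → ℂ),
      B12FormatPlus.FormatPlusG (fun n => recordDomSys F Mc k (recordK₀ F Mc k + n)) (fun n => recordBondCount F (recordK₀ F Mc k + n))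
          (fun n => recordAct F (recordK₀ F Mc k + n)) (fun n => recordUc F Mc k α₀ α₁ (recordK₀ F Mc k + n))
          (fun n => recordCoords F Mc k (recordK₀ F Mc k + n)) (fun n => recordChartDimJ F (recordK₀ F Mc k + n))
          (fun n => recordChartJ F Mc k (recordK₀ F Mc k + n)) (fun n => recordΦfAx F a₀ ε₂₉ k v (recordK₀ F Mc k + n))
          (fun n => recordEmbJ F θ k (recordK₀ F Mc k + n)) (fun n => recordWrapCtr F Mc k (recordK₀ F Mc k + n))
          (fun n => recordDomEmbCtr F Mc k (recordK₀ F Mc k + n)) (fun n _ => recordCoordProjCtr F (recordK₀ F Mc k + n)) E₀ κ →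
      (∀ n, ∀ᶠ B in 𝓝 (0 : recordW F a₀ ε₂₉ k (recordK₀ F Mc k + n)), ∀ X : (recordDomSys F Mc k (recordK₀ F Mc k + n)).Dom,
          ∃ g : recordGaugeGrp F (recordK₀ F Mc k + n), ∀ i ∈ recordCoords F Mc k (recordK₀ F Mc k + n) X,
            recordChartJ F Mc k (recordK₀ F Mc k + n) X (ιC n B) i =
              recordAct F (recordK₀ F Mc k + n) g (recordChartJ F Mc k (recordK₀ F Mc k + n) X (recordEmbJ F θ k (recordK₀ F Mc k + n) B)) i) →
      (∀ a : θ.ιβ, Response9D (dataG F Mc k (recordK₀ F Mc k) (fun n => G n a)) (fun n => recordChartJ F Mc k (recordK₀ F Mc k + n))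
          (fun n => recordRNat F Mc k (recordK₀ F Mc k + n)) (fun n X => recordDom44J F Mc k (recordK₀ F Mc k + n) X (min (1 / 4 : ℝ) (min α₁ (α₀ / 36)))) C₉ δ₀) →
      (∀ n : ℕ, ContDiffAt ℝ 2 (ιC n) 0 ∧ ιC n 0 = 0) →
      (∀ (n : ℕ) (a : θ.ιβ) (l : RespLabel F k (recordK₀ F Mc k + n)),
          G n a l = fun i => fderiv ℝ (ιC n) 0 (Pi.single l.1 (Pi.single l.2 (θ.bV a))) i) →
      ((∀ n, B12Decay510.GeomLeaf (recordSiteGeom F Mc k (recordK₀ F Mc k + n)) (recordRho F k (recordK₀ F Mc k + n)) Mg c₁ ∧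
            B12Decay510.CubeSumLeaf (recordSiteGeom F Mc k (recordK₀ F Mc k + n)) (δ₀ / 2) K₁ ∧
            B12Decay510.TreeLeaf (recordCc F Mc k (recordK₀ F Mc k + n)) (κ / 2) K₀') ∧
        ∀ (μ ν : Fin 4) (z : Fin 4 → ℤ), ∀ᶠ n in atTop,
          recordRho F k (recordK₀ F Mc k + n) (recordE F k (recordK₀ F Mc k + n) μ 0) (recordE F k (recordK₀ F Mc k + n) ν z) = B12Sec2to5.l1 z) →
      PolLimitExists F (k + 1) (fun K => recordTermsAx F a₀ ε₂₉ k v K) θ.ρ8 θ.bV →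
      B12Sec2to5.Decay510 (recordPlimAx F a₀ ε₂₉ k v 0 1)
        (16 * E₀ * C₉ ^ 2 * Real.exp (B12Decay510.delta1 δ₀ κ Mg * Mg * c₁) * K₀' * K₁) (B12Decay510.delta1 δ₀ κ Mg) := by
  classical
  intro F a₀ ε₂₉ α₀ α₁ hα₀ hα₁ Mc k v ιC G hFmt hsw hResp hreg hGk hG h121
  letI θ := thetaFill F a₀ ε₂₉; letI := θ.instVβ₁; letI := θ.instVβ₂; letI := θ.instιβ
  have hFmtC := formatPlusG_chartSwap hFmt hsw
  refine PortH.decay510_plimOf_of_rows_trace F (recordTermsAx F a₀ ε₂₉) θ.ρ8 θ.bV k v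
    (fun n => recordUc F Mc k α₀ α₁ (recordK₀ F Mc k + n)) (fun n => recordCoords F Mc k (recordK₀ F Mc k + n))
    (fun n => recordChartJ F Mc k (recordK₀ F Mc k + n))
    (fun n X => recordDom44J F Mc k (recordK₀ F Mc k + n) X (min (1 / 4 : ℝ) (min α₁ (α₀ / 36))))
    (fun n => recordAct F (recordK₀ F Mc k + n)) (fun n => recordToG F (recordK₀ F Mc k + n)) (fun n => recordAdJ F (recordK₀ F Mc k + n))
    (flipG F Mc k (recordK₀ F Mc k) (fun n => G n (recordAStar F a₀ ε₂₉))) (fun n => recordK₀ F Mc k + n)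
    (fun n a (y : RespLabel F k (recordK₀ F Mc k + n)) => G n a y) ιC
    hE₀ hκ.le hC₉ hδ₀.le hMg hK₀' hFmtC (chart44DJ_record F Mc k hα₀ hα₁)
    (chartEquivariant_members Mc k (recordK₀ F Mc k)) (noInvariantCovector_members (recordK₀ F Mc k))
    (chart_cut_members_G F Mc k (recordK₀ F Mc k) (fun n => G n (recordAStar F a₀ ε₂₉)) _)
    (fun n a X y => (response9D_flipG F Mc k (recordK₀ F Mc k) (fun n => G n a) (hResp a)).2.2.1 n X y)
    (fun n => (hG.1 n).1) (fun n => (hG.1 n).2.1) (fun n => (hG.1 n).2.2) (fun μ ν z => ?_)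
    (fun n => ⟨(hreg n).2, (hreg n).1, fun a μ z => hGk n a _⟩)
    (limit121_members (recordTermsAx F a₀ ε₂₉) θ.ρ8 θ.bV k v (recordK₀ F Mc k) h121)
  refine (hG.2 μ ν (-z)).mono fun n hn => ?_
  rw [flipG_e, flipG_e, neg_zero, ← l1_neg z]
  exact hn

/-! ## §11b  The box edition with a GENERIC table: (L-dec-box) from D1 AT EVERY BOX HISTORY + the chart rows + RowG + the (1.21) box letter -/

/-- ★★★ **(L-dec-box) FROM THE DISPLAYED ROWS, GENERIC TABLE `G`** — ONE chart `ιC`; ⁸'s mould AT EVERY `v ∈ FlowStep.Box γ₀ k` (D1 on the box) · the swap row · per `k`: «Prop. 9» receipts for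
`dataG … (G k · a)` ∀ colours ∧ `C²`∕zero ∧ the link · RowG per `k` · the (1.21) box letter `PolLimitOnBoxOf … γ₀` ⟹ **`PlimDecayOnBoxOf … γ₀ (16·E₀·C₉²·e^{δ₁Mg c₁}·K₀′·K₁) (delta1 δ₀ κ Mg)`**
(§11a at each box history).  CONDITIONAL: every displayed row is a hypothesis; nothing of Bałaban asserted; K0ᴬ 27238 OPEN; the Yang–Mills mass gap is NOT proved.
[cite: Balaban1987RG1, Thm 1 p.259, Thm 3 p.264, (1.18)–(1.22) pp.263–264, (4.35)–(4.37) pp.290–291, (5.10) p.293; Balaban1985Variational, Prop. 9 p.309, (21) p.281] -/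
theorem plimDecayOnBoxOf_of_rows_box_G {E₀ κ C₉ δ₀ Mg c₁ K₀' K₁ : ℝ}
    (hE₀ : 0 ≤ E₀) (hκ : 0 < κ) (hC₉ : 0 ≤ C₉) (hδ₀ : 0 < δ₀) (hMg : 0 < Mg) (hK₀' : 0 ≤ K₀') :
    ∀ (F : T4Family) (a₀ ε₂₉ γ₀ α₀ α₁ : ℝ), 0 < α₀ → 0 < α₁ → ∀ (Mc : ℕ),
      letI θ := thetaFill F a₀ ε₂₉; letI := θ.instVβ₁; letI := θ.instVβ₂; letI := θ.instιβ
      ∀ (ιC : (k n : ℕ) → recordW F a₀ ε₂₉ k (recordK₀ F Mc k + n) → (Fin (recordChartDimJ F (recordK₀ F Mc k + n)) → ℂ))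
        (G : (k n : ℕ) → θ.ιβ → RespLabel F k (recordK₀ F Mc k + n) → Fin (recordChartDimJ F (recordK₀ F Mc k + n)) → ℂ),
      (∀ (k : ℕ) (v : Fin (k + 1) → ℝ), v ∈ FlowStep.Box γ₀ k →
        B12FormatPlus.FormatPlusG (fun n => recordDomSys F Mc k (recordK₀ F Mc k + n)) (fun n => recordBondCount F (recordK₀ F Mc k + n))
          (fun n => recordAct F (recordK₀ F Mc k + n)) (fun n => recordUc F Mc k α₀ α₁ (recordK₀ F Mc k + n))
          (fun n => recordCoords F Mc k (recordK₀ F Mc k + n)) (fun n => recordChartDimJ F (recordK₀ F Mc k + n))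
          (fun n => recordChartJ F Mc k (recordK₀ F Mc k + n)) (fun n => recordΦfAx F a₀ ε₂₉ k v (recordK₀ F Mc k + n))
          (fun n => recordEmbJ F θ k (recordK₀ F Mc k + n)) (fun n => recordWrapCtr F Mc k (recordK₀ F Mc k + n))
          (fun n => recordDomEmbCtr F Mc k (recordK₀ F Mc k + n)) (fun n _ => recordCoordProjCtr F (recordK₀ F Mc k + n)) E₀ κ) →
      (∀ (k n : ℕ), ∀ᶠ B in 𝓝 (0 : recordW F a₀ ε₂₉ k (recordK₀ F Mc k + n)), ∀ X : (recordDomSys F Mc k (recordK₀ F Mc k + n)).Dom,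
          ∃ g : recordGaugeGrp F (recordK₀ F Mc k + n), ∀ i ∈ recordCoords F Mc k (recordK₀ F Mc k + n) X,
            recordChartJ F Mc k (recordK₀ F Mc k + n) X (ιC k n B) i =
              recordAct F (recordK₀ F Mc k + n) g (recordChartJ F Mc k (recordK₀ F Mc k + n) X (recordEmbJ F θ k (recordK₀ F Mc k + n) B)) i) →
      (∀ k : ℕ, (∀ a : θ.ιβ, Response9D (dataG F Mc k (recordK₀ F Mc k) (fun n => G k n a)) (fun n => recordChartJ F Mc k (recordK₀ F Mc k + n))
            (fun n => recordRNat F Mc k (recordK₀ F Mc k + n)) (fun n X => recordDom44J F Mc k (recordK₀ F Mc k + n) X (min (1 / 4 : ℝ) (min α₁ (α₀ / 36)))) C₉ δ₀) ∧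
          (∀ n : ℕ, ContDiffAt ℝ 2 (ιC k n) 0 ∧ ιC k n 0 = 0) ∧
          ∀ (n : ℕ) (a : θ.ιβ) (l : RespLabel F k (recordK₀ F Mc k + n)),
            G k n a l = fun i => fderiv ℝ (ιC k n) 0 (Pi.single l.1 (Pi.single l.2 (θ.bV a))) i) →
      (∀ k : ℕ, (∀ n, B12Decay510.GeomLeaf (recordSiteGeom F Mc k (recordK₀ F Mc k + n)) (recordRho F k (recordK₀ F Mc k + n)) Mg c₁ ∧
            B12Decay510.CubeSumLeaf (recordSiteGeom F Mc k (recordK₀ F Mc k + n)) (δ₀ / 2) K₁ ∧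
            B12Decay510.TreeLeaf (recordCc F Mc k (recordK₀ F Mc k + n)) (κ / 2) K₀') ∧
        ∀ (μ ν : Fin 4) (z : Fin 4 → ℤ), ∀ᶠ n in atTop,
          recordRho F k (recordK₀ F Mc k + n) (recordE F k (recordK₀ F Mc k + n) μ 0) (recordE F k (recordK₀ F Mc k + n) ν z) = B12Sec2to5.l1 z) →
      PolLimitOnBoxOf F (recordTermsAx F a₀ ε₂₉) θ.ρ8 θ.bV γ₀ →
      PlimDecayOnBoxOf F (recordTermsAx F a₀ ε₂₉) θ.ρ8 θ.bV γ₀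
        (16 * E₀ * C₉ ^ 2 * Real.exp (B12Decay510.delta1 δ₀ κ Mg * Mg * c₁) * K₀' * K₁) (B12Decay510.delta1 δ₀ κ Mg) := by
  intro F a₀ ε₂₉ γ₀ α₀ α₁ hα₀ hα₁ Mc ιC G h8 hsw h9 hG hlim
  exact ⟨B12Decay510.delta1_pos hδ₀ hκ hMg, fun k v hv =>
    recordDecay_of_trace_G hE₀ hκ hC₉ hδ₀ hMg hK₀' F a₀ ε₂₉ α₀ α₁ hα₀ hα₁ Mc k v (ιC k) (G k) (h8 k v hv) (hsw k) (h9 k).1 (h9 k).2.1 (h9 k).2.2 (hG k)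
      (hlim k v hv)⟩

/-! ## §11c  D9 := `Response9DAtLocUnivξ` BY NAME and RowG DISCHARGED at the record names -/

/-- ★★★ **(L-dec-box), D9-XFER EDITION, RowG DISCHARGED** — §11b at the transverse whole-torus table `G k n a := recordGkLocWξ F θ k (recordK₀ F Mc k + n) Finset.univ a` (the D9 row is, BY NAME,
`∀ a, Response9DAtLocUnivξ F θ a Mc k (recordK₀ F Mc k) (min ¼ (min α₁ (α₀∕36))) C₉ δ₀`), with ALL FOUR RowG rows supplied by ✓`PortHRecordRowG.rowG_slot8_at_names` (`GeomLeaf` with `c₁ = 2` for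
`Mg ≥ 4·Mc`, cube-sum leaf at `δ₀∕2` with constant `(2(1 − e^{−δ₀∕2})⁻¹)⁴`, tree leaf at `κ∕2` with `B12TreeDecay.K₀ (4·2⁴) (2·4)` under `2κ₀ ≤ κ` ⟸ `4κ₀ ≤ κ`, the eventual window identification):
D1-box ∧ swap ∧ chart rows ∧ `PolLimitOnBoxOf … γ₀` ⟹ **(L-dec-box) with constant `16·E₀·C₉²·e^{2·δ₁·Mg}·K₀(4·2⁴, 2·4)·(2(1 − e^{−δ₀∕2})⁻¹)⁴`, rate `δ₁ = delta1 δ₀ κ Mg`**.  Guards: `McGuard F Mc`,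
`4·Mc ≤ Mg`, `4·κ₀(4·2⁴, 2·4) ≤ κ` (`0 < κ` follows, ✓`kappa₀_std_pos`).  CONDITIONAL; nothing of Bałaban asserted; K0ᴬ 27238 OPEN; the Yang–Mills mass gap is NOT proved.
[cite: Balaban1987RG1, Thm 1 p.259, Thm 3 p.264, §0 p.257, (0.26) pp.257–258, (1.18)–(1.22) pp.263–264, (4.35)–(4.37) pp.290–291, (5.10) p.293; Balaban1985Variational, Prop. 9 p.309; Balaban1984PropagatorsII, (2.35) p.228] -/
theorem plimDecayOnBoxOf_of_rows_box_LocUniv_geom {E₀ κ C₉ δ₀ Mg : ℝ}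
    (hE₀ : 0 ≤ E₀) (hκ₀ : 4 * B12TreeDecay.kappa₀ (4 * 2 ^ 4) (2 * 4) ≤ κ) (hC₉ : 0 ≤ C₉) (hδ₀ : 0 < δ₀) :
    ∀ (F : T4Family) (a₀ ε₂₉ γ₀ α₀ α₁ : ℝ), 0 < α₀ → 0 < α₁ → ∀ (Mc : ℕ), McGuard F Mc → 4 * (Mc : ℝ) ≤ Mg →
      letI θ := thetaFill F a₀ ε₂₉; letI := θ.instVβ₁; letI := θ.instVβ₂; letI := θ.instιβ
      ∀ ιC : (k n : ℕ) → recordW F a₀ ε₂₉ k (recordK₀ F Mc k + n) → (Fin (recordChartDimJ F (recordK₀ F Mc k + n)) → ℂ),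
      (∀ (k : ℕ) (v : Fin (k + 1) → ℝ), v ∈ FlowStep.Box γ₀ k →
        B12FormatPlus.FormatPlusG (fun n => recordDomSys F Mc k (recordK₀ F Mc k + n)) (fun n => recordBondCount F (recordK₀ F Mc k + n))
          (fun n => recordAct F (recordK₀ F Mc k + n)) (fun n => recordUc F Mc k α₀ α₁ (recordK₀ F Mc k + n))
          (fun n => recordCoords F Mc k (recordK₀ F Mc k + n)) (fun n => recordChartDimJ F (recordK₀ F Mc k + n))
          (fun n => recordChartJ F Mc k (recordK₀ F Mc k + n)) (fun n => recordΦfAx F a₀ ε₂₉ k v (recordK₀ F Mc k + n))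
          (fun n => recordEmbJ F θ k (recordK₀ F Mc k + n)) (fun n => recordWrapCtr F Mc k (recordK₀ F Mc k + n))
          (fun n => recordDomEmbCtr F Mc k (recordK₀ F Mc k + n)) (fun n _ => recordCoordProjCtr F (recordK₀ F Mc k + n)) E₀ κ) →
      (∀ (k n : ℕ), ∀ᶠ B in 𝓝 (0 : recordW F a₀ ε₂₉ k (recordK₀ F Mc k + n)), ∀ X : (recordDomSys F Mc k (recordK₀ F Mc k + n)).Dom,
          ∃ g : recordGaugeGrp F (recordK₀ F Mc k + n), ∀ i ∈ recordCoords F Mc k (recordK₀ F Mc k + n) X,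
            recordChartJ F Mc k (recordK₀ F Mc k + n) X (ιC k n B) i =
              recordAct F (recordK₀ F Mc k + n) g (recordChartJ F Mc k (recordK₀ F Mc k + n) X (recordEmbJ F θ k (recordK₀ F Mc k + n) B)) i) →
      (∀ k : ℕ, (∀ a : θ.ιβ, Response9DAtLocUnivξ F θ a Mc k (recordK₀ F Mc k) (min (1 / 4 : ℝ) (min α₁ (α₀ / 36))) C₉ δ₀) ∧
          (∀ n : ℕ, ContDiffAt ℝ 2 (ιC k n) 0 ∧ ιC k n 0 = 0) ∧
          ∀ (n : ℕ) (a : θ.ιβ) (l : RespLabel F k (recordK₀ F Mc k + n)),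
            recordGkLocWξ F θ k (recordK₀ F Mc k + n) Finset.univ a l = fun i => fderiv ℝ (ιC k n) 0 (Pi.single l.1 (Pi.single l.2 (θ.bV a))) i) →
      PolLimitOnBoxOf F (recordTermsAx F a₀ ε₂₉) θ.ρ8 θ.bV γ₀ →
      PlimDecayOnBoxOf F (recordTermsAx F a₀ ε₂₉) θ.ρ8 θ.bV γ₀
        (16 * E₀ * C₉ ^ 2 * Real.exp (B12Decay510.delta1 δ₀ κ Mg * Mg * 2) * B12TreeDecay.K₀ (4 * 2 ^ 4) (2 * 4) *
          (2 * (1 - Real.exp (-(δ₀ / 2)))⁻¹) ^ 4)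
        (B12Decay510.delta1 δ₀ κ Mg) := by
  intro F a₀ ε₂₉ γ₀ α₀ α₁ hα₀ hα₁ Mc hMc hMg4 ιC h8 hsw h9 hlim
  have hMc0 : (0 : ℝ) < Mc := by exact_mod_cast mc_pos hMc
  have hMg : 0 < Mg := by linarith
  have hκ : 0 < κ := lt_of_lt_of_le (mul_pos (by norm_num) kappa₀_std_pos) hκ₀
  have hκ2 : 2 * B12TreeDecay.kappa₀ (4 * 2 ^ 4) (2 * 4) ≤ κ := by linarith [kappa₀_std_pos.le]
  exact plimDecayOnBoxOf_of_rows_box_G hE₀ hκ hC₉ hδ₀ hMg (B12TreeDecay.K₀_pos _ _).le F a₀ ε₂₉ γ₀ α₀ α₁ hα₀ hα₁ Mc ιC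
    (fun k n a => recordGkLocWξ F (thetaFill F a₀ ε₂₉) k (recordK₀ F Mc k + n) Finset.univ a) h8 hsw
    (fun k => ⟨fun a => (h9 k).1 a, (h9 k).2.1, (h9 k).2.2⟩) (fun k => rowG_slot8_at_names hMc hMg4 hκ2 hδ₀) hlim

/-! ## §11e  (L-dec-box): D9 AND — through (E-lu-box), ✓`twoVolExpBox_LocUniv_images_geom` — the (1.21) box letter from `McGuard` + the rows alone (no token) -/

/-- ★★★ **(L-dec-box) FROM ⁸'s MOULD ON THE BOX + THE CHART ROWS AGAINST THE TRANSVERSE TABLE — NO TOKEN** — `∀ ιC, D1-box → swap → chart rows → ∃ C δ₁, 0 ≤ C ∧ (L-dec-box)(γ₀, C, δ₁)`: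
D9 by ★★★ PTB-1 ✓`PortU8.portPieceLocalityU8_LocUniv_images` (the method of images; `McGuard F Mc` and `α₂ > 0` alone) at `α₂ := min ¼ (min α₁ (α₀∕36))` (constants `C₉, δ₀` existential, revealed FIRST), the (1.21) box letter by ✓`twoVolExpBox_LocUniv_images_geom` (★ PTB-1, `…K0AxJoinTBoxD9Images` :50;
(E-lu-box), at `c₁ := 0`) + ✓`polLimitOnBoxOf_of_twoVolExpLocUnif`, RowG by ✓§11c `plimDecayOnBoxOf_of_rows_box_LocUniv_geom`.  (Q-ord): nothing follows `∃ C δ₁`.  What stays displayed: D1 on the box, the swap row and the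
`C²`∕zero∕link rows of the ONE chart `ιC` against `recordGkLocWξ … univ` (jointly (ra-1)(ra-3)(ra-4) + `DressLink` ⟸ (C-orb) — OPEN), the guards (`0 < ε₂₉`, radii, `McGuard`, `4·Mc ≤ Mg`, `4κ₀ ≤ κ`).
CONDITIONAL; nothing of Bałaban asserted; K0ᴬ 27238 OPEN; the Yang–Mills mass gap is NOT proved.
[cite: Balaban1987RG1, Thm 1 p.259, Thm 3 p.264, (1.7) p.261, (1.18)–(1.22) pp.263–264, (4.4)–(4.5) pp.281–282, (4.35)–(4.37) pp.290–291, (5.10) p.293; Balaban1985Variational, Prop. 9 p.309, (190) p.308; Balaban1984PropagatorsII, (2.35) p.228] -/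
theorem plimDecayOnBoxOf_LocUniv_images_geom {E₀ κ Mg : ℝ}
    (hE₀ : 0 ≤ E₀) (hκ₀ : 4 * B12TreeDecay.kappa₀ (4 * 2 ^ 4) (2 * 4) ≤ κ) :
    ∀ (F : T4Family) (a₀ ε₂₉ γ₀ α₀ α₁ : ℝ), 0 < ε₂₉ → 0 < α₀ → 0 < α₁ → ∀ Mc : ℕ, McGuard F Mc → 4 * (Mc : ℝ) ≤ Mg →
      letI θ := thetaFill F a₀ ε₂₉; letI := θ.instVβ₁; letI := θ.instVβ₂; letI := θ.instιβ
      ∀ ιC : (k n : ℕ) → recordW F a₀ ε₂₉ k (recordK₀ F Mc k + n) → (Fin (recordChartDimJ F (recordK₀ F Mc k + n)) → ℂ),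
      (∀ (k : ℕ) (v : Fin (k + 1) → ℝ), v ∈ FlowStep.Box γ₀ k →
        B12FormatPlus.FormatPlusG (fun n => recordDomSys F Mc k (recordK₀ F Mc k + n)) (fun n => recordBondCount F (recordK₀ F Mc k + n))
          (fun n => recordAct F (recordK₀ F Mc k + n)) (fun n => recordUc F Mc k α₀ α₁ (recordK₀ F Mc k + n))
          (fun n => recordCoords F Mc k (recordK₀ F Mc k + n)) (fun n => recordChartDimJ F (recordK₀ F Mc k + n))
          (fun n => recordChartJ F Mc k (recordK₀ F Mc k + n)) (fun n => recordΦfAx F a₀ ε₂₉ k v (recordK₀ F Mc k + n))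
          (fun n => recordEmbJ F θ k (recordK₀ F Mc k + n)) (fun n => recordWrapCtr F Mc k (recordK₀ F Mc k + n))
          (fun n => recordDomEmbCtr F Mc k (recordK₀ F Mc k + n)) (fun n _ => recordCoordProjCtr F (recordK₀ F Mc k + n)) E₀ κ) →
      (∀ (k n : ℕ), ∀ᶠ B in 𝓝 (0 : recordW F a₀ ε₂₉ k (recordK₀ F Mc k + n)), ∀ X : (recordDomSys F Mc k (recordK₀ F Mc k + n)).Dom,
          ∃ g : recordGaugeGrp F (recordK₀ F Mc k + n), ∀ i ∈ recordCoords F Mc k (recordK₀ F Mc k + n) X,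
            recordChartJ F Mc k (recordK₀ F Mc k + n) X (ιC k n B) i =
              recordAct F (recordK₀ F Mc k + n) g (recordChartJ F Mc k (recordK₀ F Mc k + n) X (recordEmbJ F θ k (recordK₀ F Mc k + n) B)) i) →
      (∀ k : ℕ, (∀ n : ℕ, ContDiffAt ℝ 2 (ιC k n) 0 ∧ ιC k n 0 = 0) ∧
          ∀ (n : ℕ) (a : θ.ιβ) (l : RespLabel F k (recordK₀ F Mc k + n)),
            recordGkLocWξ F θ k (recordK₀ F Mc k + n) Finset.univ a l = fun i => fderiv ℝ (ιC k n) 0 (Pi.single l.1 (Pi.single l.2 (θ.bV a))) i) →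
      ∃ C δ₁ : ℝ, 0 ≤ C ∧ PlimDecayOnBoxOf F (recordTermsAx F a₀ ε₂₉) θ.ρ8 θ.bV γ₀ C δ₁ := by
  intro F a₀ ε₂₉ γ₀ α₀ α₁ hε hα₀ hα₁ Mc hMc hMg4 ιC h8 hsw h9
  have hMc0 : (0 : ℝ) < Mc := by exact_mod_cast mc_pos hMc
  have hMgMc : (Mc : ℝ) ≤ Mg := by linarith
  have hκ : 0 < κ := lt_of_lt_of_le (mul_pos (by norm_num) kappa₀_std_pos) hκ₀
  have hα₂ : 0 < min (1 / 4 : ℝ) (min α₁ (α₀ / 36)) := lt_min (by norm_num) (lt_min hα₁ (by positivity))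
  obtain ⟨C₉, δ₀, hC₉, hδ₀, hpk⟩ := PortU8.portPieceLocalityU8_LocUniv_images F Mc a₀ hMc (min (1 / 4 : ℝ) (min α₁ (α₀ / 36))) hα₂
  -- the (1.21) box letter through (E-lu-box) (№8 §10e at `c₁ := 0`, then ✓ST :258)
  obtain ⟨C₉', δ₀', -, -, hE⟩ := twoVolExpBox_LocUniv_images_geom (c₁ := 0) hE₀ hκ hκ₀ le_rfl F a₀ ε₂₉ γ₀ α₀ α₁ hε hα₀ hα₁ Mc hMc hMgMc ιC h8 hsw h9
  have hlim := polLimitOnBoxOf_of_twoVolExpLocUnif F a₀ ε₂₉ hE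
  refine ⟨_, _, ?_, plimDecayOnBoxOf_of_rows_box_LocUniv_geom hE₀ hκ₀ hC₉ hδ₀ F a₀ ε₂₉ γ₀ α₀ α₁ hα₀ hα₁ Mc hMc hMg4 ιC h8 hsw
    (fun k => ⟨fun a => (hpk k ε₂₉ hε).1 a, (h9 k).1, (h9 k).2⟩) hlim⟩
  have hK₁ : (0 : ℝ) ≤ (2 * (1 - Real.exp (-(δ₀ / 2)))⁻¹) ^ 4 := Even.pow_nonneg ⟨2, rfl⟩ _
  exact mul_nonneg (mul_nonneg (mul_nonneg (mul_nonneg (mul_nonneg (by norm_num) hE₀) (sq_nonneg _)) (Real.exp_pos _).le) (B12TreeDecay.K₀_pos _ _).le) hK₁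

/-! ## §11f  (L-absmom-box) from D1-box + the chart rows (no token) -/

/-- ★★★ **(L-absmom-box) FROM D1-box + THE CHART ROWS — NO TOKEN** — §11e then ✓`recordPlimAbsMomentOnBoxAx_of_plimDecayOnBoxOf` (`M := betaPrime510 4 C δ₁`): the |β| SIZE letter of the
K0ᴬ box road is a CONSEQUENCE of the rows that already feed (E-lu-box); it is no longer an independent hypothesis of the K0ᴬ door (§11g).  CONDITIONAL; nothing of Bałaban asserted; K0ᴬ OPEN;
the Yang–Mills mass gap is NOT proved. [cite: Balaban1987RG1, Thm 3 p.264, (1.21)–(1.22) p.264, (5.10) p.293, (5.42) p.297; Balaban1985Variational, Prop. 9 p.309] -/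
theorem absMomentBox_LocUniv_images_geom {E₀ κ Mg : ℝ}
    (hE₀ : 0 ≤ E₀) (hκ₀ : 4 * B12TreeDecay.kappa₀ (4 * 2 ^ 4) (2 * 4) ≤ κ) :
    ∀ (F : T4Family) (a₀ ε₂₉ γ₀ α₀ α₁ : ℝ), 0 < ε₂₉ → 0 < α₀ → 0 < α₁ → ∀ Mc : ℕ, McGuard F Mc → 4 * (Mc : ℝ) ≤ Mg →
      letI θ := thetaFill F a₀ ε₂₉; letI := θ.instVβ₁; letI := θ.instVβ₂; letI := θ.instιβ
      ∀ ιC : (k n : ℕ) → recordW F a₀ ε₂₉ k (recordK₀ F Mc k + n) → (Fin (recordChartDimJ F (recordK₀ F Mc k + n)) → ℂ),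
      (∀ (k : ℕ) (v : Fin (k + 1) → ℝ), v ∈ FlowStep.Box γ₀ k →
        B12FormatPlus.FormatPlusG (fun n => recordDomSys F Mc k (recordK₀ F Mc k + n)) (fun n => recordBondCount F (recordK₀ F Mc k + n))
          (fun n => recordAct F (recordK₀ F Mc k + n)) (fun n => recordUc F Mc k α₀ α₁ (recordK₀ F Mc k + n))
          (fun n => recordCoords F Mc k (recordK₀ F Mc k + n)) (fun n => recordChartDimJ F (recordK₀ F Mc k + n))
          (fun n => recordChartJ F Mc k (recordK₀ F Mc k + n)) (fun n => recordΦfAx F a₀ ε₂₉ k v (recordK₀ F Mc k + n))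
          (fun n => recordEmbJ F θ k (recordK₀ F Mc k + n)) (fun n => recordWrapCtr F Mc k (recordK₀ F Mc k + n))
          (fun n => recordDomEmbCtr F Mc k (recordK₀ F Mc k + n)) (fun n _ => recordCoordProjCtr F (recordK₀ F Mc k + n)) E₀ κ) →
      (∀ (k n : ℕ), ∀ᶠ B in 𝓝 (0 : recordW F a₀ ε₂₉ k (recordK₀ F Mc k + n)), ∀ X : (recordDomSys F Mc k (recordK₀ F Mc k + n)).Dom,
          ∃ g : recordGaugeGrp F (recordK₀ F Mc k + n), ∀ i ∈ recordCoords F Mc k (recordK₀ F Mc k + n) X,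
            recordChartJ F Mc k (recordK₀ F Mc k + n) X (ιC k n B) i =
              recordAct F (recordK₀ F Mc k + n) g (recordChartJ F Mc k (recordK₀ F Mc k + n) X (recordEmbJ F θ k (recordK₀ F Mc k + n) B)) i) →
      (∀ k : ℕ, (∀ n : ℕ, ContDiffAt ℝ 2 (ιC k n) 0 ∧ ιC k n 0 = 0) ∧
          ∀ (n : ℕ) (a : θ.ιβ) (l : RespLabel F k (recordK₀ F Mc k + n)),
            recordGkLocWξ F θ k (recordK₀ F Mc k + n) Finset.univ a l = fun i => fderiv ℝ (ιC k n) 0 (Pi.single l.1 (Pi.single l.2 (θ.bV a))) i) →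
      ∃ M : ℝ, RecordPlimAbsMomentOnBoxAx F a₀ ε₂₉ γ₀ M := by
  intro F a₀ ε₂₉ γ₀ α₀ α₁ hε hα₀ hα₁ Mc hMc hMg4 ιC h8 hsw h9
  obtain ⟨C, δ₁, -, hdec⟩ := plimDecayOnBoxOf_LocUniv_images_geom hE₀ hκ₀ F a₀ ε₂₉ γ₀ α₀ α₁ hε hα₀ hα₁ Mc hMc hMg4 ιC h8 hsw h9
  exact ⟨_, recordPlimAbsMomentOnBoxAx_of_plimDecayOnBoxOf F a₀ ε₂₉ hdec⟩

/-! ## §11g  The cofinal-radii K0ᴬ door — NO MOMENT LETTER, NO TOKEN -/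

/-- ★ **THE COFINAL-RADII K0ᴬ DOOR WITHOUT A MOMENT LETTER AND WITHOUT A TOKEN**: if for every continuum family and cofinally small radii `a₀ ≤ a` there are `γ₀ ∈ ]0, ½]`, `ε₂₉ > 0`, format constants `E₀ ≥ 0`,
`κ ≥ 4·κ₀(4·2⁴, 2·4)`, a mask letter `Mg ≥ 4·Mc`, chart radii `α₀, α₁ > 0` and an admissible cube letter `Mc` (`McGuard`) such that [∃ ONE chart `ιC`: ⁸'s mould D1 AT EVERY
BOX HISTORY ∧ the swap row ∧ the `C²`∕zero∕link rows against `recordGkLocWξ … univ`] holds, THEN K0ᴬ `Record13SepCoPHInhabitedAx` holds BY NAME — §11f gives (L-absmom-box), then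
✓`record13SepCoPHInhabitedAx_of_k0AbsMomentBoxCofinalRadiiAx`.  = ✓№8's door `record13SepCoPHInhabitedAx_of_cmp_chartRowsBox_pvolAbsMomentBox_cofinalRadii` (:363) with the conjuncts (V-absmom-box) AND `TokCmpUCap F Mc a₀`
DELETED (and the `0 < κ`, `0 ≤ c₁` guards gone; `Mc ≤ Mg` ↦ `4·Mc ≤ Mg`, free for an existential `Mg`).  NET: **K0ᴬ BY NAME ⟸ D1 on the box ∧ the chart rows of ONE `ιC` ∧ guards, at cofinal radii.**  CONDITIONAL door: every conjunct of `H` is OPEN content (D1-box = W1 ⟨27930⟩'s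
consequent on the box, not its signed runs edition; the chart rows = (ra-1)(ra-3)(ra-4) + `DressLink` ⟸ (C-orb)); K0ᴬ 27238 OPEN; NODE O 0∕1; the Yang–Mills mass gap is NOT proved.
[cite: Balaban1987RG1, Thm 1 p.259, Thm 3 p.264, (0.20) p.256, (1.7) p.261, (1.18)–(1.22) pp.263–264, (4.35)–(4.37) pp.290–291, (5.10) p.293, (5.42) p.297; Balaban1985Variational, Prop. 9 p.309, (190) p.308; Balaban1984PropagatorsII, (2.130) p.246] -/
theorem record13SepCoPHInhabitedAx_of_chartRowsBox_cofinalRadii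
    (H : ∀ F : T4Family, ∀ a : ℝ, 0 < a → ∃ a₀ : ℝ, 0 < a₀ ∧ a₀ ≤ a ∧ ∃ (γ₀ ε₂₉ E₀ κ Mg α₀ α₁ : ℝ) (Mc : ℕ),
      0 < γ₀ ∧ γ₀ ≤ 1 / 2 ∧ 0 < ε₂₉ ∧ 0 ≤ E₀ ∧ 4 * B12TreeDecay.kappa₀ (4 * 2 ^ 4) (2 * 4) ≤ κ ∧ 0 < α₀ ∧ 0 < α₁ ∧ McGuard F Mc ∧ 4 * (Mc : ℝ) ≤ Mg ∧
      (letI θ := thetaFill F a₀ ε₂₉; letI := θ.instVβ₁; letI := θ.instVβ₂; letI := θ.instιβ;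
        ∃ ιC : (k n : ℕ) → recordW F a₀ ε₂₉ k (recordK₀ F Mc k + n) → (Fin (recordChartDimJ F (recordK₀ F Mc k + n)) → ℂ),
        (∀ (k : ℕ) (v : Fin (k + 1) → ℝ), v ∈ FlowStep.Box γ₀ k →
          B12FormatPlus.FormatPlusG (fun n => recordDomSys F Mc k (recordK₀ F Mc k + n)) (fun n => recordBondCount F (recordK₀ F Mc k + n))
            (fun n => recordAct F (recordK₀ F Mc k + n)) (fun n => recordUc F Mc k α₀ α₁ (recordK₀ F Mc k + n))
            (fun n => recordCoords F Mc k (recordK₀ F Mc k + n)) (fun n => recordChartDimJ F (recordK₀ F Mc k + n))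
            (fun n => recordChartJ F Mc k (recordK₀ F Mc k + n)) (fun n => recordΦfAx F a₀ ε₂₉ k v (recordK₀ F Mc k + n))
            (fun n => recordEmbJ F θ k (recordK₀ F Mc k + n)) (fun n => recordWrapCtr F Mc k (recordK₀ F Mc k + n))
            (fun n => recordDomEmbCtr F Mc k (recordK₀ F Mc k + n)) (fun n _ => recordCoordProjCtr F (recordK₀ F Mc k + n)) E₀ κ) ∧
        (∀ (k n : ℕ), ∀ᶠ B in 𝓝 (0 : recordW F a₀ ε₂₉ k (recordK₀ F Mc k + n)), ∀ X : (recordDomSys F Mc k (recordK₀ F Mc k + n)).Dom,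
            ∃ g : recordGaugeGrp F (recordK₀ F Mc k + n), ∀ i ∈ recordCoords F Mc k (recordK₀ F Mc k + n) X,
              recordChartJ F Mc k (recordK₀ F Mc k + n) X (ιC k n B) i =
                recordAct F (recordK₀ F Mc k + n) g (recordChartJ F Mc k (recordK₀ F Mc k + n) X (recordEmbJ F θ k (recordK₀ F Mc k + n) B)) i) ∧
        (∀ k : ℕ, (∀ n : ℕ, ContDiffAt ℝ 2 (ιC k n) 0 ∧ ιC k n 0 = 0) ∧
            ∀ (n : ℕ) (a : θ.ιβ) (l : RespLabel F k (recordK₀ F Mc k + n)),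
              recordGkLocWξ F θ k (recordK₀ F Mc k + n) Finset.univ a l = fun i => fderiv ℝ (ιC k n) 0 (Pi.single l.1 (Pi.single l.2 (θ.bV a))) i))) :
    Summit.QuantumFields.YangMills.Theses.BalabanUVNodes.Record13SepCoPHInhabitedAx := by
  refine record13SepCoPHInhabitedAx_of_k0AbsMomentBoxCofinalRadiiAx fun F a ha => ?_
  obtain ⟨a₀, ha₀, hle, γ₀, ε₂₉, E₀, κ, Mg, α₀, α₁, Mc, hγ₀, hγh, hε, hE₀, hκ₀, hα₀, hα₁, hMc, hMg4, ιC, h8, hsw, h9⟩ := H F a ha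
  obtain ⟨M, hM⟩ := absMomentBox_LocUniv_images_geom hE₀ hκ₀ F a₀ ε₂₉ γ₀ α₀ α₁ hε hα₀ hα₁ Mc hMc hMg4 ιC h8 hsw h9
  exact ⟨a₀, ha₀, hle, γ₀, ε₂₉, M, hγ₀, hγh, hε, hM⟩

-- standard axioms only
#print axioms record13SepCoPHInhabitedAx_of_chartRowsBox_cofinalRadii

end Summit.QuantumFields.YangMills.Theorems.K0AxMomentRoad

end
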